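import Summits.QuantumFields.YangMills.Theorems.UnitScaleTiltHistoryTailOfPackagePinnedLf
import Summits.QuantumFields.YangMills.Theorems.UnitScaleTiltHistoryTailOfPinnedHeightTailFreeRate
import HarnessLib

/-!
# THE PINNED-STABILITY LINE'S CRUX FACE — `UnitScaleTilt.HistoryTailL` FROM THE v1 T3 (α) SOCKET, THE POLYMER FIELDS, THE EX-LANE MAIN-TERM ROW AND THE TWO LARGE-FIELD
# ORGAN ROWS READ `dV`-A.E. (`hSii` pinned, `hlf` un-pinned) — the one-line composition of ✓`UnitScaleTiltHistoryTailOfPackagePinnedLf` with the LEAD's K-19′ socket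

Cell `ym3-torus` (YM ladder rung R3 = continuum `SU(2)` Yang–Mills on the three-torus — a RUNG, NOT d = 4, NOT infinite volume, NOT a mass gap, NOT Clay).
Twin-width seat `ym-ust-19936-w8` (gen 11); `--supports stmt-QuantumFields-19936 --as helper`, count-neutral, definition-free, default heartbeats.  LEAD ★`ym-ust-19936-w1` g11 «GO»
(2026-08-29T23:26:59Z), ★★OWNER WORDS 57∕58 (display letter = final organ rows; hJ twin after `ym-ust-19936-w6` g7's FILE 3).
**19936 CRUX FACE OVER THE LEAD SOCKET ✓p748552; CONDITIONAL, CLOSES NOTHING.  IT DOES NOT PROVE `HistoryTailL`.**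

★★★ `historyTailL_of_package_of_pinnedLF_of_lf_ae_of_main (hpkg) (π) (hMain) (hSii) (hlf) : …Theses.UnitScaleTilt.HistoryTailL` :=
✓`historyTailL_of_pinnedHeightTail_freeRate (pinnedHeightTail_of_package_of_pinnedLF_of_lf_ae_of_main hpkg π hMain hSii hlf)`.  Rows displayed: `hpkg : ∀ L, AlphaInputsT3AC L` (the UV3
node's (α) package, hypothesis schema), `π` (polymer fields), `hMain` (EX-lane membership row), `hSii` (pinned restricted-sum resummation, a.e.), `hlf` (un-pinned top-level leaf B25, a.e.);
both organ rows reduce to ONE row hJ (top-level a.e. mass envelope of the transported history masses) by `ym-ust-19936-w6` g7's FILES 1–3 — the hJ-lettered twin is appended then.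

References: T. Bałaban, Commun. Math. Phys. **102** (1985) 255–275 [Balaban1985UV3] (Thm 1 (5) p.256, (41) p.266, (47) p.267, (67), (70)–(71) p.273, pp.273–274).
-/

set_option autoImplicit false

noncomputable section

namespace Summit.QuantumFields.YangMills.Theorems.UnitScaleTiltHistoryTailOfPackagePinnedLfCrux

open MeasureTheory
open Literature.MathematicalPhysics.QuantumFieldTheory.Balaban1983to89
open Literature.MathematicalPhysics.QuantumFieldTheory.Balaban1983to89.T3ContinuumYM3Torus
open Literature.MathematicalPhysics.QuantumFieldTheory.Balaban1983to89.T3UnitScaleTilt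
open Literature.MathematicalPhysics.QuantumFieldTheory.Balaban1983to89.T3UnitLawDensityEML
open Literature.MathematicalPhysics.QuantumFieldTheory.Balaban1983to89.T3RestrictedUnitDensity
open Literature.MathematicalPhysics.QuantumFieldTheory.Balaban1983to89.T3AlphaInputsAC
open Literature.MathematicalPhysics.QuantumFieldTheory.Balaban1985CMP102
open Literature.MathematicalPhysics.QuantumFieldTheory.Balaban1985CMP102.Setting
open Summit.QuantumFields.Balaban3D.Carriers
open Summit.QuantumFields.Balaban3D.Proofs.Primitives
open Summit.QuantumFields.Balaban3D.Proofs.StandardAC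
open Summit.QuantumFields.Balaban3D.Proofs.InputsAC
open Summit.QuantumFields.YangMills.Theorems.UnitScaleTiltHistoryTailOfPackagePinnedLf (pinnedHeightTail_of_package_of_pinnedLF_of_lf_ae_of_main)
open Summit.QuantumFields.YangMills.Theorems.UnitScaleTiltHistoryTailOfPinnedHeightTailFreeRate (historyTailL_of_pinnedHeightTail_freeRate)

open Classical in
/-- ★★★ **`UnitScaleTilt.HistoryTailL` FROM THE v1 (α) SOCKET, THE POLYMER FIELDS, THE MAIN-TERM ROW AND THE TWO LARGE-FIELD ORGAN ROWS READ A.E.** (the PinnedStability line's crux face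
over the LEAD socket ✓`historyTailL_of_pinnedHeightTail_freeRate`; CONDITIONAL — it does NOT prove `HistoryTailL`: `hSii`∕`hlf` are Bałaban's large-field control for the `blockAvg ℰp`
tower, `hpkg` is the (α) package, `hMain` the EX lane). [cite: Balaban1985UV3, Thm 1 (5) p.256, (41) p.266, (47) p.267, (67), (70)-(71) p.273, pp.273-274] -/
theorem historyTailL_of_package_of_pinnedLF_of_lf_ae_of_main
    (hpkg : ∀ L : ℕ, AlphaInputsT3AC L)
    (π : ∀ F : T3Family, AlphaInputsT3AC.PolymerT3 F)
    (hMain : ∀ (F : T3Family) (𝔠 : AlphaConsts F.L (suGroupModel 2).N) (h : AlphaInputsT3AC.Of F 𝔠) (γ : ℝ) (hγ : 0 < γ)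
      (hγ1 : γ ≤ (min 𝔠.gamma0 1) ^ 2), ∃ Cm : ℝ, ∀ (K : ℕ) (W : GaugeField (F.P K) K (Matrix.specialUnitaryGroup (Fin 2) ℂ)),
        PlaqSmall (θBal F.L γ 𝔠.b₀ 𝔠.p₀ 0) W →
          (h.dataT3 γ hγ hγ1 (π F)).mainT K K ((h.dataT3 γ hγ hγ1 (π F)).triv K K) W ≤ Cm)
    (hSii : ∀ (L : ℕ) (𝔠 : AlphaConsts L (suGroupModel 2).N)
      (hOf : ∀ (F : T3Family) (hF : F.L = L), AlphaInputsT3AC.Of F (hF ▸ 𝔠)),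
        ∀ (m : ℕ), 0 < m →
          ∃ γ₁ : ℝ, 0 < γ₁ ∧ ∀ (F : T3Family) (hF : F.L = L)
            (γ : ℝ) (hγ : 0 < γ) (hγ1' : γ ≤ (min (hF ▸ 𝔠).gamma0 1) ^ 2), γ ≤ γ₁ →
            ∃ (CZ c : ℝ) (A : ℕ), 0 < c ∧
              ∀ (K j : ℕ) (hj1 : 1 ≤ j) (hjK : j + 2 ≤ K), j + (K - 1) / m ≤ K → ∀ (a : Plaq (F.P K) j),
                ∀ᵐ W ∂(fieldMeasure (F.P K) K (Matrix.specialUnitaryGroup (Fin 2) ℂ)),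
                ∑ r ∈ Finset.univ.filter (fun r : Hist (F.P K) K =>
                    a ∈ r ⟨j, by omega⟩ ∨ ¬ plaqCover a ⊆ Omega (hF ▸ 𝔠).lane.carrier.M₁
                      (rcolOf (T3Scales F γ hγ (hγ1'.trans (sq_min_one_le _ (hF ▸ 𝔠).gamma0_pos)) K) (hF ▸ 𝔠).lane.carrier) j
                      (fun i : Fin j => r (Fin.castLE (by omega) i)) j),
                  (inputOfAC (hF ▸ 𝔠).lane ((hOf F hF).pkgAt γ hγ hγ1' K).X ((hOf F hF).pkgAt γ hγ hγ1' K).𝔖).W.mass K r W *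
                    Real.exp (-(((hOf F hF).pkgAt γ hγ hγ1' K).T.mainT K r W) + ((hOf F hF).pkgAt γ hγ hγ1' K).T.Zterm K r) ≤
                Real.exp CZ * ((F.scheme ℰp γ).β (K - j) ^ A *
                  Real.exp (-(c * B10.pFun (hF ▸ 𝔠).b₀ (hF ▸ 𝔠).p₀ (Real.sqrt (γ * ((F.L : ℝ)⁻¹) ^ (K - j))) ^ 2))))
    (hlf : ∀ (F : T3Family) (𝔠 : AlphaConsts F.L (suGroupModel 2).N) (h : AlphaInputsT3AC.Of F 𝔠) (γ : ℝ) (hγ : 0 < γ)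
      (hγ1 : γ ≤ (min 𝔠.gamma0 1) ^ 2), ∃ CZ : ℝ, ∀ K : ℕ, ∀ᵐ W ∂fieldMeasure (F.P K) K (Matrix.specialUnitaryGroup (Fin 2) ℂ),
        (h.dataT3 γ hγ hγ1 (π F)).LF K K W
            (fun hh => -((h.dataT3 γ hγ hγ1 (π F)).mainT K K hh W) + (h.dataT3 γ hγ hγ1 (π F)).Zterm K K hh) ≤ Real.exp CZ) :
    Summit.QuantumFields.YangMills.Theses.UnitScaleTilt.HistoryTailL :=
  historyTailL_of_pinnedHeightTail_freeRate (pinnedHeightTail_of_package_of_pinnedLF_of_lf_ae_of_main hpkg π hMain hSii hlf)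

end Summit.QuantumFields.YangMills.Theorems.UnitScaleTiltHistoryTailOfPackagePinnedLfCrux

end
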